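import Summits.Ventures.PercRepro.ThetaOmegaCorePair

/-!
# Three bad one-edge points are impossible

Dossier proofs/MINE1-theoremS.md, Addendum 81 (mine-1, gen 42). Two bad edges (`BadEdge` of
`ThetaOmegaCorePair.lean`) are chained or in general position — the V and Λ shapes fall to
`not_badV` / `not_badLambda` (`chained_or_nonDeg`). Three bad edges are then impossible: all three
pairs chained is a cardinality contradiction (`chained3_false`); two chained pairs and one in
general position form a path of three edges whose end colours contradict the types
(`config2_false`, Boolean core `bool_chain3`); one chained pair and two in general position make
the two mono colours of the chain equal, which the types and the positions of the third point
refute (`config3_false`, `bool_cfg3`); three pairs in general position give three pairwise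
complementary mono colours (`config4_false`). **`three_bad_false`**: a family has at most two
points carrying a bad edge.
-/

namespace PercRepro.MSTight

open Finset

variable {α : Type*} [DecidableEq α]

section Three

variable {q r p : α} {U : Finset α} {F : Finset (Finset α)} {c0 c1 : Finset α → Bool}
  {s t w : Finset α}

/-- **Chained or in general position**: the V and Λ shapes are excluded. -/
theorem chained_or_nonDeg (hq : BadEdge U F c0 c1 q s) (hr : BadEdge U F c0 c1 r t) (hqr : q ≠ r) :
    Chained q s r t ∨ NonDeg q s r t := by
  by_cases h1 : t = insert q s
  · exact Or.inl (Or.inl h1)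
  by_cases h2 : insert r t = s
  · exact Or.inl (Or.inr h2)
  by_cases h3 : t = s
  · -- a V
    exfalso
    subst h3
    exact not_badV hq.1 hr.1 hqr hq.2.1 hq.2.2.1 hr.2.2.1 hq.2.2.2.1 hr.2.2.2.1 hq.2.2.2.2.1
      hr.2.2.2.2.1 hq.2.2.2.2.2 hr.2.2.2.2.2
  by_cases h4 : insert r t = insert q s
  · -- a Λ
    exfalso
    have hqu : q ∈ insert q s := mem_insert_self q s
    have hru : r ∈ insert q s := h4 ▸ mem_insert_self r t
    have hes : (insert q s).erase q = s := erase_insert hq.2.2.1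
    have het : (insert q s).erase r = t := by rw [← h4]; exact erase_insert hr.2.2.1
    refine not_badLambda hq.1 hr.1 hqr hq.2.2.2.1 hqu hru ?_ ?_ ?_ ?_ hq.2.2.2.2.2 hr.2.2.2.2.2
    · rw [hes]; exact hq.2.1
    · rw [het]; exact hr.2.1
    · rw [hes]; exact hq.2.2.2.2.1
    · rw [het, ← h4]; exact hr.2.2.2.2.1
  exact Or.inr ⟨h3, h1, h2, h4⟩

/-- The cardinalities of the lower ends of chained edges differ by one. -/
theorem card_of_chained (hq : BadEdge U F c0 c1 q s) (hr : BadEdge U F c0 c1 r t)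
    (h : Chained q s r t) : t.card = s.card + 1 ∨ s.card = t.card + 1 := by
  rcases h with h | h
  · left; rw [h]; exact card_insert_of_notMem hq.2.2.1
  · right; rw [← h]; exact card_insert_of_notMem hr.2.2.1

/-- **All three pairs chained is impossible** (three cardinalities pairwise differing by one). -/
theorem chained3_false (hq : BadEdge U F c0 c1 q s) (hr : BadEdge U F c0 c1 r t)
    (hp : BadEdge U F c0 c1 p w) (h12 : Chained q s r t) (h13 : Chained q s p w)
    (h23 : Chained r t p w) : False := by
  have := card_of_chained hq hr h12
  have := card_of_chained hq hp h13
  have := card_of_chained hr hp h23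
  omega

/-- **Three pairs in general position are impossible**: the three mono colours would be pairwise
complementary. -/
theorem config4_false (hq : BadEdge U F c0 c1 q s) (hr : BadEdge U F c0 c1 r t)
    (hp : BadEdge U F c0 c1 p w) (hqr : q ≠ r) (hqp : q ≠ p) (hrp : r ≠ p)
    (n12 : NonDeg q s r t) (n13 : NonDeg q s p w) (n23 : NonDeg r t p w) : False :=
  bool_three_ne (monoColour c0 c1 q s) (monoColour c0 c1 r t) (monoColour c0 c1 p w)
    (Ne.symm (nonDeg_monoColour_ne hq hr hqr n12)) (Ne.symm (nonDeg_monoColour_ne hq hp hqp n13))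
    (Ne.symm (nonDeg_monoColour_ne hr hp hrp n23))

/-- **Two chained pairs at a common point and one pair in general position are impossible**: the
three edges form a path whose end colours contradict the types. -/
theorem config2_false (hq : BadEdge U F c0 c1 q s) (hr : BadEdge U F c0 c1 r t)
    (hp : BadEdge U F c0 c1 p w) (hrp : r ≠ p)
    (c12 : Chained q s r t) (c13 : Chained q s p w) (n23 : NonDeg r t p w) : False := by
  rcases c12 with ht | hv <;> rcases c13 with hw | hz
  · -- a V at `r, p`
    exact n23.1 (hw.trans ht.symm)
  · -- the path `w — s — u — v` in directions `p, q, r` (`s = w + p`, `u = s + q`, `v = u + r`)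
    subst ht
    subst hz
    have hps : p ∈ insert p w := mem_insert_self p w
    have hpt : p ∈ insert q (insert p w) := mem_insert_of_mem hps
    have hqu : q ∈ insert q (insert p w) := mem_insert_self q _
    have hqv : q ∈ insert r (insert q (insert p w)) := mem_insert_of_mem hqu
    have hqs : q ∉ insert p w := hq.2.2.1
    have hqw : q ∉ w := fun h => hqs (mem_insert_of_mem h)
    have hrw : r ∉ w := fun h => hr.2.2.1 (mem_insert_of_mem (mem_insert_of_mem h))
    have hrs : r ∉ insert p w := fun h => hr.2.2.1 (mem_insert_of_mem h)
    have hpw : p ∉ w := hp.2.2.1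
    -- third members for the types
    have tp := badEdge_typed hp hq.2.2.2.1 (ne_of_mem_notMem hqu hqw) (ne_of_mem_notMem hqu hqs)
    have tq := badEdge_typed hq hp.2.1 (ne_of_mem_notMem hps hpw).symm
      (Ne.symm (ne_of_mem_notMem hqu hqw))
    have tr := badEdge_typed hr hq.2.1 (Ne.symm (ne_of_mem_notMem hqu hqs))
      (Ne.symm (ne_of_mem_notMem (mem_insert_self r _) hrs))
    -- the outer edges are consistent across the path
    have hL1 := nondeg_c0_eq_of_mem hp hr (nonDeg_symm n23) hpt
    have hL2 := nondeg_c1_eq_of_notMem hr hp hrp n23 hrw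
    exact bool_chain3 _ _ _ _ _ _ _ _ hp.2.2.2.2.1 hq.2.2.2.2.1 hr.2.2.2.2.1 tp tq tr hL2 hL1
  · -- the path `t — s — u — z` in directions `r, q, p` (`s = t + r`, `u = s + q`, `z = u + p`)
    subst hv
    subst hw
    have hrs : r ∈ insert r t := mem_insert_self r t
    have hru : r ∈ insert q (insert r t) := mem_insert_of_mem hrs
    have hqu : q ∈ insert q (insert r t) := mem_insert_self q _
    have hqs : q ∉ insert r t := hq.2.2.1
    have hqt : q ∉ t := fun h => hqs (mem_insert_of_mem h)
    have hpu : p ∉ insert q (insert r t) := hp.2.2.1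
    have hpt : p ∉ t := fun h => hpu (mem_insert_of_mem (mem_insert_of_mem h))
    have hps : p ∉ insert r t := fun h => hpu (mem_insert_of_mem h)
    have hrt : r ∉ t := hr.2.2.1
    -- third members for the types
    have tr := badEdge_typed hr hp.2.1 (ne_of_mem_notMem hqu hqt) (ne_of_mem_notMem hqu hqs)
    have tq := badEdge_typed hq hr.2.1 (ne_of_mem_notMem hrs hrt).symm
      (ne_of_mem_notMem hqu hqt).symm
    have tp := badEdge_typed hp hq.2.1 (Ne.symm (ne_of_mem_notMem hqu hqs))
      (Ne.symm (ne_of_mem_notMem (mem_insert_self p _) hps))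
    have hL1 := nondeg_c1_eq_of_notMem hp hr (Ne.symm hrp) (nonDeg_symm n23) hpt
    have hL2 := nondeg_c0_eq_of_mem hr hp n23 hru
    exact bool_chain3 _ _ _ _ _ _ _ _ hr.2.2.2.2.1 hq.2.2.2.2.1 hp.2.2.2.2.1 tr tq tp hL1 hL2
  · -- a Λ at `r, p`
    exact n23.2.2.2 (hz.trans hv.symm)

/-- **One chained pair and two pairs in general position are impossible**: the third point makes
the two mono colours of the chain equal, which the types and its positions refute. -/
theorem config3_false (hq : BadEdge U F c0 c1 q s) (hr : BadEdge U F c0 c1 r t)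
    (hp : BadEdge U F c0 c1 p w) (hqp : q ≠ p) (hrp : r ≠ p)
    (c12 : Chained q s r t) (n13 : NonDeg q s p w) (n23 : NonDeg r t p w) : False := by
  have hmc : monoColour c0 c1 q s = monoColour c0 c1 r t :=
    bool_eq_of_ne_of_ne' _ _ _ (nonDeg_monoColour_ne hq hp hqp n13)
      (nonDeg_monoColour_ne hr hp hrp n23)
  have tq := badEdge_typed hq hp.2.1 n13.1 n13.2.1
  have tr := badEdge_typed hr hp.2.1 n23.1 n23.2.1
  -- the positions of `p` relative to the two edges
  have hLq : ∀ _ : p ∈ s, c0 s = c0 (insert q s) :=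
    fun h => nondeg_c0_eq_of_mem hp hq (nonDeg_symm n13) h
  have hLq' : ∀ _ : p ∉ s, c1 s = c1 (insert q s) :=
    fun h => nondeg_c1_eq_of_notMem hp hq (Ne.symm hqp) (nonDeg_symm n13) h
  have hLr : ∀ _ : p ∈ t, c0 t = c0 (insert r t) :=
    fun h => nondeg_c0_eq_of_mem hp hr (nonDeg_symm n23) h
  have hLr' : ∀ _ : p ∉ t, c1 t = c1 (insert r t) :=
    fun h => nondeg_c1_eq_of_notMem hp hr (Ne.symm hrp) (nonDeg_symm n23) h
  rcases c12 with ht | hv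
  · -- `t = s + q`: `p ∈ s → p ∈ t`
    subst ht
    have hL : (c0 s = c0 (insert q s) ∧ c0 (insert q s) = c0 (insert r (insert q s))) ∨
        (c1 s = c1 (insert q s) ∧ (c0 (insert q s) = c0 (insert r (insert q s)) ∨
          c1 (insert q s) = c1 (insert r (insert q s)))) := by
      by_cases hps : p ∈ s
      · exact Or.inl ⟨hLq hps, hLr (mem_insert_of_mem hps)⟩
      · refine Or.inr ⟨hLq' hps, ?_⟩
        by_cases hpt : p ∈ insert q s
        · exact Or.inl (hLr hpt)
        · exact Or.inr (hLr' hpt)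
    exact bool_cfg3 _ _ _ _ _ _ hq.2.2.2.2.1 hr.2.2.2.2.1 tq tr hmc hL
  · -- `s = t + r`: `p ∈ t → p ∈ s`
    subst hv
    have hL : (c0 t = c0 (insert r t) ∧ c0 (insert r t) = c0 (insert q (insert r t))) ∨
        (c1 t = c1 (insert r t) ∧ (c0 (insert r t) = c0 (insert q (insert r t)) ∨
          c1 (insert r t) = c1 (insert q (insert r t)))) := by
      by_cases hpt : p ∈ t
      · exact Or.inl ⟨hLr hpt, hLq (mem_insert_of_mem hpt)⟩
      · refine Or.inr ⟨hLr' hpt, ?_⟩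
        by_cases hps : p ∈ insert r t
        · exact Or.inl (hLq hps)
        · exact Or.inr (hLq' hps)
    exact bool_cfg3 _ _ _ _ _ _ hr.2.2.2.2.1 hq.2.2.2.2.1 tr tq hmc.symm hL

/-- **THREE BAD EDGES ARE IMPOSSIBLE.** -/
theorem three_bad_false (hq : BadEdge U F c0 c1 q s) (hr : BadEdge U F c0 c1 r t)
    (hp : BadEdge U F c0 c1 p w) (hqr : q ≠ r) (hqp : q ≠ p) (hrp : r ≠ p) : False := by
  rcases chained_or_nonDeg hq hr hqr with c12 | n12 <;>
    rcases chained_or_nonDeg hq hp hqp with c13 | n13 <;>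
    rcases chained_or_nonDeg hr hp hrp with c23 | n23
  · exact chained3_false hq hr hp c12 c13 c23
  · exact config2_false hq hr hp hrp c12 c13 n23
  · exact config2_false hr hq hp hqp (chained_symm c12) c23 n13
  · exact config3_false hq hr hp hqp hrp c12 n13 n23
  · exact config2_false hp hq hr hqr (chained_symm c13) (chained_symm c23) n12
  · exact config3_false hq hp hr hqr (Ne.symm hrp) c13 n12 (nonDeg_symm n23)
  · exact config3_false hr hp hq (Ne.symm hqr) (Ne.symm hqp) c23 (nonDeg_symm n12)
      (nonDeg_symm n13)
  · exact config4_false hq hr hp hqr hqp hrp n12 n13 n23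

end Three

end PercRepro.MSTight
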